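import Summits.CriticalPhenomena.PercolationContinuityZ3.Theorems.PercNearOneGluingNoHeavyLowerTailSunflowerThreeBlockCombReduction
import HarnessLib
import HarnessLib.Audit

/-!
# `NoHeavyLowerTail` (crux stmt-CriticalPhenomena-4575), abstract sunflower cubic: the THREE-BLOCK theorem II — the depth-first checker over all
# monotone maps `[3]³ → M₃` with canonical petal names, and its SOUNDNESS

Support file (seat `prim-ineq-gen-2` gen 21; `--supports stmt-CriticalPhenomena-4575`; sequel of `…SunflowerThreeBlockCombReduction`).  No `sorry`, no named facts,
standard axioms (the compiled evaluation of `checkAll` lives in the companion `…SunflowerThreeBlockComb`, `--computational`).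
Memo: run/shared/lean/prim/prim-ineq-gen-2/THREEBLOCK-LEAN-GEN21.md.

THE SEARCH (`dfs`, `checkAll = dfs 27 #[]`).  The `27` cells of `[3]³` are assigned in the fixed order `cellList` (ranks `0, 6, 1, 5, 2, 4, 3`: extremes first);
a value `x : Fin 5` is ADMISSIBLE after the partial assignment `arr` (`okVal`) iff it is diamond-comparable with every earlier comparable cell (tables `belowA`,
`aboveA`; only their soundness `belowA_spec`/`aboveA_spec` is used) and respects canonical petal names (`2,3` need an earlier `1`; `3` needs an earlier `2`);
at depth `27` the LEAF test asks that the three table-driven reduced generic sums `T0A KHa/KGa/KTa` (flat value tables of `s6H, s6G, s6T`; triple table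
`tripA` of the `36` transversal triples with block `0` in natural order) are `≥ 0`.  Outside Lean: `595 433` leaves, `1 585 688` nodes, all sums `≥ 0`, minimum `0`.

SOUNDNESS (`dfs_sound`, by induction on the remaining depth, no enumeration inside the kernel): if `ψ` is GOOD (`IsGood cellAt ψ`: monotone with canonical petal
names along `cellList`) and `arr` agrees with `ψ` on the assigned cells, then `dfs` visits the branch `x = ψ (next cell)` (`okVal_of_good`), so `dfs … = true` forces
the leaf reached along `ψ` to pass, i.e. `0 ≤ T0 κ ψ` (`T0A_eq`: the table-driven sum of the full assignment is `T0`).  With `exists_good` and `Tgen_eq_six_mul_T0`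
(part I): **`comb_height_two_of_checkAll : checkAll = true → ∀ G c, 0 ≤ ZFC s6H G c ∧ 0 ≤ ZFC s6G G c ∧ 0 ≤ ZFC s6T G c`** for every height-two three-block
quotient `G` — the hypothesis (H2) of `ChainComb.comb_chain_of_height_two` / `ZH_composeC_nonneg_of_height_two` for `B = Fin 3`.
-/

namespace Summit.CriticalPhenomena.PercolationContinuityZ3.Theorems.SunflowerPartition

open Finset

namespace ThreeBlockComb

open ChainComb

/-! ## §1. The checker -/

/-- The DFS cell order: ranks `0, 6, 1, 5, 2, 4, 3` (extremes first). [this work] -/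
def cellList : List Lv :=
  [![0, 0, 0], ![2, 2, 2], ![0, 0, 1], ![0, 1, 0], ![1, 0, 0], ![1, 2, 2], ![2, 1, 2], ![2, 2, 1], ![0, 0, 2], ![0, 1, 1], ![0, 2, 0],
    ![1, 0, 1], ![1, 1, 0], ![2, 0, 0], ![0, 2, 2], ![1, 1, 2], ![1, 2, 1], ![2, 0, 2], ![2, 1, 1], ![2, 2, 0], ![0, 1, 2], ![0, 2, 1],
    ![1, 0, 2], ![1, 1, 1], ![1, 2, 0], ![2, 0, 1], ![2, 1, 0]]

/-- The cell at a depth. [this work] -/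
def cellAt (d : ℕ) : Lv := cellList.getD d ![0, 0, 0]

/-- Every level vector occurs in the cell order. [this work] -/
theorem exists_cellAt_eq : ∀ v : Lv, ∃ d : Fin 27, cellAt d.val = v := by
  unfold cellAt cellList; decide

/-- For each depth, earlier depths whose cell lies BELOW the current cell. [this work] -/
def belowA : Array (List ℕ) :=
  #[[], [0], [0], [0], [0], [0, 2, 3, 4], [0, 2, 3, 4], [0, 2, 3, 4], [0, 2], [0, 2, 3], [0, 3], [0, 2, 4], [0, 3, 4], [0, 4],
    [0, 2, 3, 8, 9, 10], [0, 2, 3, 4, 8, 9, 11, 12], [0, 2, 3, 4, 9, 10, 11, 12], [0, 2, 4, 8, 11, 13], [0, 2, 3, 4, 9, 11, 12, 13],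
    [0, 3, 4, 10, 12, 13], [0, 2, 3, 8, 9], [0, 2, 3, 9, 10], [0, 2, 4, 8, 11], [0, 2, 3, 4, 9, 11, 12], [0, 3, 4, 10, 12],
    [0, 2, 4, 11, 13], [0, 3, 4, 12, 13]]

/-- For each depth, earlier depths whose cell lies ABOVE the current cell. [this work] -/
def aboveA : Array (List ℕ) :=
  #[[], [], [1], [1], [1], [1], [1], [1], [1, 5, 6], [1, 5, 6, 7], [1, 5, 7], [1, 5, 6, 7], [1, 5, 6, 7], [1, 6, 7], [1, 5], [1, 5, 6],
    [1, 5, 7], [1, 6], [1, 6, 7], [1, 7], [1, 5, 6, 14, 15], [1, 5, 7, 14, 16], [1, 5, 6, 15, 17], [1, 5, 6, 7, 15, 16, 18],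
    [1, 5, 7, 16, 19], [1, 6, 7, 17, 18], [1, 6, 7, 18, 19]]

/-- The depth triples of the `36` transversal triples with block `0` in natural order (index `6 j + k`). [this work] -/
def tripA : Array (ℕ × ℕ × ℕ) :=
  #[(0, 23, 1), (2, 12, 1), (8, 23, 19), (0, 15, 7), (2, 15, 19), (8, 12, 7), (3, 11, 1), (9, 4, 1), (20, 11, 19), (3, 22, 7),
    (9, 22, 19), (20, 4, 7), (10, 23, 17), (21, 12, 17), (14, 23, 13), (10, 15, 25), (21, 15, 13), (14, 12, 25), (0, 16, 6),
    (2, 24, 6), (8, 16, 26), (0, 5, 18), (2, 5, 26), (8, 24, 18), (3, 16, 17), (9, 24, 17), (20, 16, 13), (3, 5, 25), (9, 5, 13),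
    (20, 24, 25), (10, 11, 6), (21, 4, 6), (14, 11, 26), (10, 22, 18), (21, 22, 26), (14, 4, 18)]

/-- Flat value table of `s6H` (index `25 x + 5 y + z`). [this work] -/
def KHa : Array ℤ :=
  #[0, 0, 0, 0, 2, 0, 0, -1, -1, 0, 0, -1, 0, -1, 0, 0, -1, -1, 0, 0, 2, 0, 0, 0, 2, 0, 0, -1, -1, 0, 0, 0, 0, 0, 0, -1, 0, 0, -1, -1,
    -1, 0, -1, 0, -1, 0, 0, -1, -1, 0, 0, -1, 0, -1, 0, -1, 0, 0, -1, -1, 0, 0, 0, 0, 0, -1, -1, 0, 0, -1, 0, -1, 0, -1, 0, 0, -1, -1,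
    0, 0, -1, 0, -1, 0, -1, -1, -1, 0, 0, -1, 0, 0, 0, 0, 0, 0, -1, -1, 0, 0, 2, 0, 0, 0, 2, 0, 0, -1, -1, 0, 0, -1, 0, -1, 0, 0,
    -1, -1, 0, 0, 2, 0, 0, 0, 0]

/-- Flat value table of `s6G`. [this work] -/
def KGa : Array ℤ :=
  #[0, 0, 0, 0, 2, 0, 0, -1, -1, 1, 0, -1, 0, -1, 1, 0, -1, -1, 0, 1, 2, 1, 1, 1, 2, 0, 0, -1, -1, 1, 0, 0, -2, -2, 0, -1, -2, -2,
    -4, -1, -1, -2, -4, -2, -1, 1, 0, -1, -1, 0, 0, -1, 0, -1, 1, -1, -2, -2, -4, -1, 0, -2, 0, -2, 0, -1, -4, -2, -2, -1, 1, -1,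
    0, -1, 0, 0, -1, -1, 0, 1, -1, -2, -4, -2, -1, -1, -4, -2, -2, -1, 0, -2, -2, 0, 0, 1, -1, -1, 0, 0, 2, 1, 1, 1, 2, 1, 0, -1,
    -1, 0, 1, -1, 0, -1, 0, 1, -1, -1, 0, 0, 2, 0, 0, 0, 0]

/-- Flat value table of `s6T`. [this work] -/
def KTa : Array ℤ :=
  #[0, 0, 0, 0, 2, 0, 0, -1, -1, 1, 0, -1, 0, -1, 1, 0, -1, -1, 0, 1, 2, 1, 1, 1, 4, 0, 0, -1, -1, 1, 0, 0, -2, -2, 0, -1, -2, -2,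
    -4, -2, -1, -2, -4, -2, -2, 1, 0, -2, -2, 0, 0, -1, 0, -1, 1, -1, -2, -2, -4, -2, 0, -2, 0, -2, 0, -1, -4, -2, -2, -2, 1, -2,
    0, -2, 0, 0, -1, -1, 0, 1, -1, -2, -4, -2, -2, -1, -4, -2, -2, -2, 0, -2, -2, 0, 0, 1, -2, -2, 0, 0, 2, 1, 1, 1, 4, 1, 0, -2,
    -2, 0, 1, -2, 0, -2, 0, 1, -2, -2, 0, 0, 4, 0, 0, 0, 0]

/-- The product order on level vectors as a Boolean. [this work] -/
def leB (v w : Lv) : Bool := decide (v 0 ≤ w 0) && decide (v 1 ≤ w 1) && decide (v 2 ≤ w 2)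

/-- `leB` is the product order. [this work] -/
theorem le_of_leB {v w : Lv} (h : leB v w = true) : v ≤ w := by
  simp only [leB, Bool.and_eq_true, decide_eq_true_eq] at h
  intro b
  fin_cases b
  · exact h.1.1
  · exact h.1.2
  · exact h.2

/-- Soundness of the `below` table: every listed depth is earlier and its cell is below. [this work] -/
theorem belowA_spec : ∀ d < 27, ∀ e ∈ belowA.getD d [], e < d ∧ leB (cellAt e) (cellAt d) = true := by
  unfold belowA cellAt cellList leB; decide

/-- Soundness of the `above` table. [this work] -/
theorem aboveA_spec : ∀ d < 27, ∀ e ∈ aboveA.getD d [], e < d ∧ leB (cellAt d) (cellAt e) = true := by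
  unfold aboveA cellAt cellList leB; decide

/-- Index into the flat kernel tables. [this work] -/
def kIdx (x y z : Fin 5) : ℕ := 25 * x.val + 5 * y.val + z.val

/-- The flat table is `s6H`. [this work] -/
theorem KHa_spec : ∀ x y z : Fin 5, KHa.getD (kIdx x y z) 0 = s6H x y z := by
  decide +kernel
/-- The flat table is `s6G`. [this work] -/
theorem KGa_spec : ∀ x y z : Fin 5, KGa.getD (kIdx x y z) 0 = s6G x y z := by
  decide +kernel
/-- The flat table is `s6T`. [this work] -/
theorem KTa_spec : ∀ x y z : Fin 5, KTa.getD (kIdx x y z) 0 = s6T x y z := by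
  decide +kernel

/-- Soundness of the triple table: entry `(j,k)` lists the depths of the three points of the transversal triple `![0, j, k]`. [this work] -/
theorem tripA_spec : ∀ j k : Fin 6,
    cellAt (tripA.getD (finProdFinEquiv (j, k)).val (0, 0, 0)).1 = pt ![0, j, k] 0 ∧
    cellAt (tripA.getD (finProdFinEquiv (j, k)).val (0, 0, 0)).2.1 = pt ![0, j, k] 1 ∧
    cellAt (tripA.getD (finProdFinEquiv (j, k)).val (0, 0, 0)).2.2 = pt ![0, j, k] 2 ∧
    (tripA.getD (finProdFinEquiv (j, k)).val (0, 0, 0)).1 < 27 ∧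
    (tripA.getD (finProdFinEquiv (j, k)).val (0, 0, 0)).2.1 < 27 ∧
    (tripA.getD (finProdFinEquiv (j, k)).val (0, 0, 0)).2.2 < 27 := by
  unfold tripA cellAt cellList pt; decide

/-- Reading a partial assignment (default `0` beyond its size). [this work] -/
def rd (arr : Array (Fin 5)) (d : ℕ) : Fin 5 := arr.getD d 0

/-- The table-driven reduced generic sum of a full assignment. [this work] -/
def T0A (K : Array ℤ) (arr : Array (Fin 5)) : ℤ :=
  ∑ q : Fin 36, K.getD (kIdx (rd arr (tripA.getD q.val (0, 0, 0)).1) (rd arr (tripA.getD q.val (0, 0, 0)).2.1)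
    (rd arr (tripA.getD q.val (0, 0, 0)).2.2)) 0

/-- The leaf test: the three reduced generic sums are nonnegative. [this work] -/
def leaf (arr : Array (Fin 5)) : Bool :=
  decide (0 ≤ T0A KHa arr) && decide (0 ≤ T0A KGa arr) && decide (0 ≤ T0A KTa arr)

/-- Compatibility of a value at the next depth with the values already assigned (diamond order along comparabilities). [this work] -/
def compat (arr : Array (Fin 5)) (x : Fin 5) : Bool :=
  (belowA.getD arr.size []).all (fun e => mleB (rd arr e) x) && (aboveA.getD arr.size []).all (fun e => mleB x (rd arr e))

/-- Admissible next values: compatible, and canonical petal names (`2,3` need an earlier `1`; `3` needs an earlier `2`). [this work] -/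
def okVal (arr : Array (Fin 5)) (x : Fin 5) : Bool :=
  compat arr x && (decide (x ≠ 2 ∧ x ≠ 3) || arr.contains 1) && (decide (x ≠ 3) || arr.contains 2)

/-- The five values. [this work] -/
def vals : List (Fin 5) := [0, 1, 2, 3, 4]

/-- Every value is listed. [this work] -/
theorem mem_vals : ∀ x : Fin 5, x ∈ vals := by decide

/-- Depth-first search over all admissible assignments of the remaining `n` cells. [this work] -/
def dfs : ℕ → Array (Fin 5) → Bool
  | 0, arr => leaf arr
  | n + 1, arr => vals.all fun x => !okVal arr x || dfs n (arr.push x)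

/-- **The finite check**: all `27` cells, from the empty assignment. [this work] -/
def checkAll : Bool := dfs 27 #[]

/-! ## §2. Soundness of the checker -/

/-- The assignment agrees with `ψ` read along the cell order. [this work] -/
def Agrees (ψ : Lv → Fin 5) (arr : Array (Fin 5)) : Prop := ∀ e < arr.size, rd arr e = ψ (cellAt e)

/-- Reading below the old size is unchanged by a push. [this work] -/
theorem rd_push_lt {arr : Array (Fin 5)} {x : Fin 5} {e : ℕ} (he : e < arr.size) : rd (arr.push x) e = rd arr e := by
  simp only [rd, Array.getD_eq_getD_getElem?, Array.getElem?_push, if_neg (Nat.ne_of_lt he)]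

/-- Reading the pushed value. [this work] -/
theorem rd_push_size (arr : Array (Fin 5)) (x : Fin 5) : rd (arr.push x) arr.size = x := by
  simp [rd, Array.getD_eq_getD_getElem?]

/-- Reading inside the array. [this work] -/
theorem rd_eq_getElem {arr : Array (Fin 5)} {e : ℕ} (he : e < arr.size) : rd arr e = arr[e] := by
  simp [rd, Array.getD_eq_getD_getElem?, Array.getElem?_eq_getElem he]

/-- Agreement is preserved by pushing the next value of `ψ`. [this work] -/
theorem agree_push {ψ : Lv → Fin 5} {arr : Array (Fin 5)} (h : Agrees ψ arr) : Agrees ψ (arr.push (ψ (cellAt arr.size))) := by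
  intro e he
  rw [Array.size_push] at he
  rcases Nat.lt_succ_iff_lt_or_eq.1 he with he' | he'
  · rw [rd_push_lt he']
    exact h e he'
  · subst he'
    exact rd_push_size _ _

/-- A value of `ψ` occurring before the current depth is contained in the assignment. [this work] -/
theorem contains_of_agree {ψ : Lv → Fin 5} {arr : Array (Fin 5)} (h : Agrees ψ arr) {e : ℕ} (he : e < arr.size) {y : Fin 5}
    (hy : ψ (cellAt e) = y) : arr.contains y = true := by
  rw [Array.contains_iff_mem, Array.mem_iff_getElem]
  refine ⟨e, he, ?_⟩
  rw [← rd_eq_getElem he, h e he, hy]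

/-- **The next value of a good map is admissible.** [this work] -/
theorem okVal_of_good {ψ : Lv → Fin 5} (hψ : IsGood cellAt ψ) {arr : Array (Fin 5)} (h : Agrees ψ arr) (hd : arr.size < 27) :
    okVal arr (ψ (cellAt arr.size)) = true := by
  obtain ⟨hmono, hP1, hP2⟩ := hψ
  simp only [okVal, Bool.and_eq_true, Bool.or_eq_true, decide_eq_true_eq]
  refine ⟨⟨?_, ?_⟩, ?_⟩
  · simp only [compat, Bool.and_eq_true, List.all_eq_true]
    constructor
    · intro e he
      obtain ⟨hed, hle⟩ := belowA_spec _ hd e he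
      rw [h e hed]
      exact hmono (le_of_leB hle)
    · intro e he
      obtain ⟨hed, hle⟩ := aboveA_spec _ hd e he
      rw [h e hed]
      exact hmono (le_of_leB hle)
  · by_cases h23 : ψ (cellAt arr.size) = 2 ∨ ψ (cellAt arr.size) = 3
    · obtain ⟨e, hed, he1⟩ := hP1 _ hd h23
      exact Or.inr (contains_of_agree h hed he1)
    · push Not at h23
      exact Or.inl h23
  · by_cases h3 : ψ (cellAt arr.size) = 3
    · obtain ⟨e, hed, he2⟩ := hP2 _ hd h3
      exact Or.inr (contains_of_agree h hed he2)
    · exact Or.inl h3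

/-- The table-driven sum of a full assignment agreeing with `ψ` is the reduced generic sum of `ψ`. [this work] -/
theorem T0A_eq {K : Array ℤ} {κ : Fin 5 → Fin 5 → Fin 5 → ℤ} (hK : ∀ x y z : Fin 5, K.getD (kIdx x y z) 0 = κ x y z)
    {arr : Array (Fin 5)} {ψ : Lv → Fin 5} (hag : ∀ d < 27, rd arr d = ψ (cellAt d)) : T0A K arr = T0 κ ψ := by
  unfold T0A T0
  rw [← Fintype.sum_prod_type']
  symm
  refine Fintype.sum_equiv finProdFinEquiv (fun p : Fin 6 × Fin 6 => term κ ψ ![0, p.1, p.2]) _ fun p => ?_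
  obtain ⟨j, k⟩ := p
  obtain ⟨h0, h1, h2, hl0, hl1, hl2⟩ := tripA_spec j k
  show term κ ψ ![0, j, k] = _
  rw [hag _ hl0, hag _ hl1, hag _ hl2, h0, h1, h2, hK]
  rfl

/-- **SOUNDNESS OF THE SEARCH**: if the search from an assignment agreeing with a good map `ψ` succeeds, the three reduced generic sums of `ψ`
are nonnegative. [this work] -/
theorem dfs_sound (ψ : Lv → Fin 5) (hψ : IsGood cellAt ψ) (n : ℕ) :
    ∀ arr : Array (Fin 5), Agrees ψ arr → arr.size + n = 27 → dfs n arr = true →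
      0 ≤ T0 s6H ψ ∧ 0 ≤ T0 s6G ψ ∧ 0 ≤ T0 s6T ψ := by
  induction n with
  | zero =>
    intro arr hag hsz h
    have hag' : ∀ d < 27, rd arr d = ψ (cellAt d) := fun d hd => hag d (by omega)
    have h' : leaf arr = true := h
    simp only [leaf, Bool.and_eq_true, decide_eq_true_eq] at h'
    rw [T0A_eq KHa_spec hag', T0A_eq KGa_spec hag', T0A_eq KTa_spec hag'] at h'
    exact ⟨h'.1.1, h'.1.2, h'.2⟩
  | succ n ih =>
    intro arr hag hsz h
    have hd : arr.size < 27 := by omega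
    have h' : (vals.all fun x => !okVal arr x || dfs n (arr.push x)) = true := h
    rw [List.all_eq_true] at h'
    have hx := h' (ψ (cellAt arr.size)) (mem_vals _)
    rw [okVal_of_good hψ hag hd] at hx
    simp only [Bool.not_true, Bool.false_or] at hx
    exact ih _ (agree_push hag) (by rw [Array.size_push]; omega) hx

/-- The reduced generic sums of a GOOD map are nonnegative once the check succeeds. [this work] -/
theorem T0_nonneg_of_good (hc : checkAll = true) (ψ : Lv → Fin 5) (hψ : IsGood cellAt ψ) :
    0 ≤ T0 s6H ψ ∧ 0 ≤ T0 s6G ψ ∧ 0 ≤ T0 s6T ψ :=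
  dfs_sound ψ hψ 27 #[] (fun e he => absurd he (by simp)) rfl hc

/-- **The reduced generic sums of every MONOTONE map are nonnegative** once the check succeeds (petal renaming). [this work] -/
theorem T0_nonneg_of_checkAll (hc : checkAll = true) (ψ : Lv → Fin 5) (hψ : IsMonoM3 ψ) :
    0 ≤ T0 s6H ψ ∧ 0 ≤ T0 s6G ψ ∧ 0 ≤ T0 s6T ψ := by
  obtain ⟨ψ', hgood, hT⟩ := exists_good cellAt ψ hψ
  have h := T0_nonneg_of_good hc ψ' hgood
  rw [hT s6H isPetalInv_s6H, hT s6G isPetalInv_s6G, hT s6T isPetalInv_s6T] at h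
  exact h

/-- **The generic class sums of every monotone map are nonnegative** once the check succeeds. [this work] -/
theorem Tgen_nonneg_of_checkAll (hc : checkAll = true) (ψ : Lv → Fin 5) (hψ : IsMonoM3 ψ) :
    0 ≤ Tgen s6H ψ ∧ 0 ≤ Tgen s6G ψ ∧ 0 ≤ Tgen s6T ψ := by
  obtain ⟨hH, hG, hT⟩ := T0_nonneg_of_checkAll hc ψ hψ
  rw [Tgen_eq_six_mul_T0 isSym3_s6H, Tgen_eq_six_mul_T0 isSym3_s6G, Tgen_eq_six_mul_T0 isSym3_s6T]
  exact ⟨by positivity, by positivity, by positivity⟩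

/-- **COMB_chain for every height-two three-block quotient and the three kernels**, once the check succeeds. [this work] -/
theorem comb_height_two_of_checkAll (hc : checkAll = true) (G : Sunflower (Σ b : Fin 3, Fin (two (Fin 3) b)))
    (c : ∀ b : Fin 3, Fin 3 → Fin (two (Fin 3) b + 1)) : 0 ≤ ZFC s6H G c ∧ 0 ≤ ZFC s6G G c ∧ 0 ≤ ZFC s6T G c :=
  ⟨comb_of_Tgen s6H (fun ψ hψ => (Tgen_nonneg_of_checkAll hc ψ hψ).1) G c,
    comb_of_Tgen s6G (fun ψ hψ => (Tgen_nonneg_of_checkAll hc ψ hψ).2.1) G c,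
    comb_of_Tgen s6T (fun ψ hψ => (Tgen_nonneg_of_checkAll hc ψ hψ).2.2) G c⟩

end ThreeBlockComb

end Summit.CriticalPhenomena.PercolationContinuityZ3.Theorems.SunflowerPartition
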